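import Summits.KontsevichZagierPeriods.KontsevichZagierPeriods.Theses.FurushoPentagon
import Summits.KontsevichZagierPeriods.KontsevichZagierPeriods.Theses.HermiteRigidity
import Summits.KontsevichZagierPeriods.KontsevichZagierPeriods.Theorems.HermiteRigidityReductionRigidityOfCubes
import Summits.KontsevichZagierPeriods.KontsevichZagierPeriods.Theorems.FurushoPentagonSectorToKernelCubeResolutionOfNash
import Summits.KontsevichZagierPeriods.KontsevichZagierPeriods.Theorems.FurushoPentagonSectorToKernelSaAnalyticOffSmall
import Summits.KontsevichZagierPeriods.KontsevichZagierPeriods.Theorems.FurushoPentagonSectorToKernelAffineOpenBand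
import Summits.KontsevichZagierPeriods.KontsevichZagierPeriods.Theorems.FurushoPentagonSectorToKernelCadRefine
import Summits.KontsevichZagierPeriods.KontsevichZagierPeriods.Theorems.FurushoPentagonSectorToKernelCadCellFacts
import Summits.KontsevichZagierPeriods.KontsevichZagierPeriods.Theorems.FurushoPentagonSectorToKernelNashCellReductionOf
import Summits.KontsevichZagierPeriods.KontsevichZagierPeriods.Theorems.FurushoPentagonSectorToKernelPowerSubstToTame

/-!
# `SectorToKernel` (stmt-KontsevichZagierPeriods-10813), line `effective-cube-surjection`: proof skeleton v7

Lead c22 (2026-08-17).  v6/v6.1 reshaped S1 (= item 17978 `CubeResolution`) along 17978's registered split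
`nashCellReduction ∧ openCubeNashResolution` and cut `nashCellReduction` into A–D + F; ALL of A, B, C, D, F are
now LANDED and imported above (A `stub_saAnalyticOffSmall` p147371, B `stub_affineOpenBand` p147423,
C `stub_cadRefine` p147390, D `stub_cadCellFacts` p148206, F `stub_nashCellReductionOf` p148522 with its
sub-goals `straighten_step` p148219 / `nash_cad` p148220 / `nashCellReduction_of_cad` p148221), as is the
dimension-free last step of G, `powerSubstToTame` p148223 (and the corner blow-up move, proposing).  v7
therefore has exactly TWO sorried stubs:

* G `stub_openCubeNashResolution` — 17978's second stub VERBATIM (XL: embedded resolution / rectilinearisation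
  of the boundary singularities of an open-cube Nash integrand as rule-(2) moves; NOT staffed by this lead);
* H `stub_ayoubEffectiveCubeKernel` — item stmt-18116 VERBATIM (Ayoub 2015 Conj. 1.1 at `k = ℚ`, OPEN).

`nashCellReduction` (17978's first stub) is obtained below by `exact` from the landed pieces;
`SectorToKernel_of` : the crux BY NAME (`nashCellReduction` + G ⇒ `CubeResolution` = item 17978 by
`CubeResolution_of_stubs`; with H, the landed `kernelForm_of_cubes`).
-/

noncomputable section

namespace Summit.KontsevichZagierPeriods.FurushoPentagon.SectorToKernel

open Set MeasureTheory
open Literature.ModelTheory.ExponentialFields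
open Literature.NumberTheory.Transcendental
open Literature.NumberTheory.Transcendental.KZ hiding cubicalSpan
open Summit.KontsevichZagierPeriods.FurushoPentagon.ReducedPeriodRing (unitCube cubicalGens cubicalSpan)
open Summit.KontsevichZagierPeriods.KontsevichZagierPeriods.Theses.FurushoPentagon
open Summit.KontsevichZagierPeriods.KontsevichZagierPeriods.Theses.HermiteRigidity (CubeResolution AyoubEffectiveCubeKernel)

/-! ## Registered stubs (v7: only G and H remain) -/

/-- **G — resolution of an open-cube Nash integrand into the tame cubical span** (= the second registered stub
`stub_openCubeNashResolution` of item stmt-KontsevichZagierPeriods-17978, line `nash-rectilinearisation`,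
VERBATIM; XL, Hironaka / Bierstone–Milman rectilinearisation as rule-(2) moves; NOT staffed by this lead).
[cite: Hironaka1964] [cite: BierstoneMilman1988, §4–5] [cite: HuberMullerStachPeriods2017, Lemma 12.2.2] -/
theorem stub_openCubeNashResolution : ∀ (m : ℕ) (v : IntegralRep m),
    v.domain = {x : Fin m → ℝ | ∀ i, 0 < x i ∧ x i < 1} →
    AnalyticOnNhd ℝ v.integrand {x : Fin m → ℝ | ∀ i, 0 < x i ∧ x i < 1} →
    ∃ c ∈ AddSubgroup.closure {d : FormalRep | ∃ (n : ℕ) (r : IntegralRep n),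
      r.domain = {x : Fin n → ℝ | ∀ i, 0 ≤ x i ∧ x i ≤ 1} ∧
      AnalyticOnNhd ℝ r.integrand {x : Fin n → ℝ | ∀ i, 0 ≤ x i ∧ x i ≤ 1} ∧ d = of r},
      of v - c ∈ relations := by
  sorry

/-- **H — the leaf (= item stmt-KontsevichZagierPeriods-18116 `HermiteRigidity.AyoubEffectiveCubeKernel`,
VERBATIM): Ayoub's effective cube conjecture over `k = ℚ`.** OPEN (period-conjecture strength).
[cite: Ayoub2015, Conj. 1.1] [cite: Fresan2024, Conj. 3.5] -/
theorem stub_ayoubEffectiveCubeKernel :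
    ∀ F ∈ Literature.NumberTheory.Transcendental.AyoubRel.Oan (Rat.castHom ℂ), Literature.NumberTheory.Transcendental.AyoubRel.intC F = 0 → F ∈ Literature.NumberTheory.Transcendental.AyoubRel.kSpan (Rat.castHom ℂ) {x : Literature.NumberTheory.Transcendental.AyoubRel.CSeries | ∃ G ∈ Literature.NumberTheory.Transcendental.AyoubRel.Oan (Rat.castHom ℂ), ∃ i : ℕ, x = Literature.NumberTheory.Transcendental.AyoubRel.relAC i G} := by
  sorry

/-! ## Composition -/

/-- **`nashCellReduction` — the first registered stub of item stmt-17978, now a THEOREM**: the landed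
conditional stub F applied to the landed ingredients A, B, C, D. [cite: BochnakCosteRoy1998, Prop. 2.9.10] -/
theorem nashCellReduction : ∀ (m : ℕ) (K : IntegralRep m), Bornology.IsBounded K.domain →
    (∀ x ∈ K.domain, K.integrand x = 1) →
    ∃ c ∈ AddSubgroup.closure {d : FormalRep | ∃ v : IntegralRep m,
      v.domain = {x : Fin m → ℝ | ∀ i, 0 < x i ∧ x i < 1} ∧
      AnalyticOnNhd ℝ v.integrand {x : Fin m → ℝ | ∀ i, 0 < x i ∧ x i < 1} ∧ d = of v},
      of K - c ∈ relations :=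
  stub_nashCellReductionOf stub_saAnalyticOffSmall stub_affineOpenBand stub_cadRefine stub_cadCellFacts

/-- Closure induction: if every generator of `S` is congruent modulo relations to an element of the
subgroup `T`, so is every element of `closure S` (copied from 17978's line skeleton). [folklore] -/
theorem closure_reduces {S : Set FormalRep} {T : AddSubgroup FormalRep}
    (h : ∀ s ∈ S, ∃ t ∈ T, s - t ∈ relations) :
    ∀ c ∈ AddSubgroup.closure S, ∃ t ∈ T, c - t ∈ relations := by
  intro c hc
  induction hc using AddSubgroup.closure_induction with
  | mem x hx => exact h x hx
  | zero => exact ⟨0, T.zero_mem, by simp⟩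
  | add x y _ _ hx hy =>
    obtain ⟨a, ha, hxa⟩ := hx
    obtain ⟨b, hb, hyb⟩ := hy
    refine ⟨a + b, T.add_mem ha hb, ?_⟩
    have : x + y - (a + b) = (x - a) + (y - b) := by abel
    rw [this]
    exact relations.add_mem hxa hyb
  | neg x _ hx =>
    obtain ⟨a, ha, hxa⟩ := hx
    refine ⟨-a, T.neg_mem ha, ?_⟩
    have : -x - -a = -(x - a) := by abel
    rw [this]
    exact relations.neg_mem hxa

/-- **`CubeResolution` (item stmt-17978, BY NAME) from `nashCellReduction` and G** (17978's
`CubeResolution_of_stubs`: open-cube Nash span → tame span generator by generator, then Viu-Sos via the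
landed `cubeResolution_of_boundedVolumes`). [cite: ViuSos2021, Thm. 1.1] [folklore] -/
theorem cubeResolution_of : CubeResolution := by
  have hvol : ∀ (m : ℕ) (K : IntegralRep m), Bornology.IsBounded K.domain →
      (∀ x ∈ K.domain, K.integrand x = 1) → ∃ c : FormalRep, c ∈ cubicalSpan ∧ of K - c ∈ relations := by
    intro m K hb h1
    obtain ⟨c₁, hc₁, hK⟩ := nashCellReduction m K hb h1
    have hgen : ∀ s ∈ {d : FormalRep | ∃ v : IntegralRep m, v.domain = {x : Fin m → ℝ | ∀ i, 0 < x i ∧ x i < 1} ∧ AnalyticOnNhd ℝ v.integrand {x : Fin m → ℝ | ∀ i, 0 < x i ∧ x i < 1} ∧ d = of v}, ∃ t ∈ cubicalSpan, s - t ∈ relations := by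
      rintro s ⟨v, hvd, hva, rfl⟩
      obtain ⟨t, ht, hvt⟩ := stub_openCubeNashResolution m v hvd hva
      exact ⟨t, ht, hvt⟩
    obtain ⟨c₂, hc₂, h₁₂⟩ := closure_reduces hgen c₁ hc₁
    refine ⟨c₂, hc₂, ?_⟩
    have : of K - c₂ = (of K - c₁) + (c₁ - c₂) := by abel
    rw [this]
    exact relations.add_mem hK h₁₂
  intro N u
  obtain ⟨c, hc, huc⟩ := cubeResolution_of_boundedVolumes hvol N u
  exact ⟨c, hc, huc⟩

/-- H is item stmt-18116 (syntactically the same term). [folklore] -/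
theorem ayoubEffectiveCubeKernel_of : AyoubEffectiveCubeKernel := stub_ayoubEffectiveCubeKernel

/-- **`SectorToKernel`** from the two remaining stubs of line `effective-cube-surjection` (v7) and the theorem `nashCellReduction` through the landed
by-name composition `kernelForm_of_cubes`; the two hypotheses of the crux are idle (Anatomy).
[cite: Ayoub2015, Conj. 1.1] [cite: KontsevichZagier2001, §1.2] -/
theorem SectorToKernel_of : SectorToKernel := fun _ _ =>
  Summit.KontsevichZagierPeriods.HermiteRigidity.ReductionRigidityOfCubes.kernelForm_of_cubes
    cubeResolution_of ayoubEffectiveCubeKernel_of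

end Summit.KontsevichZagierPeriods.FurushoPentagon.SectorToKernel
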